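import Summits.RiemannHypothesis.RiemannHypothesis.Theorems.SemilocalNegCertPieces
import Summits.RiemannHypothesis.RiemannHypothesis.Theorems.SemilocalLogAtoms
import HarnessLib

/-!
# Semi-local threshold of the `{∞,2,3,5,7,11}` form, negative side: `a*({2,…,11}) ≤ 13/10`

Cell `rh-explicit` (HOME `run/shared/lean/pub/rh-explicit/`), seat cc-s2-4 gen7 (A4 SEMILOCAL-TABLE row `{∞,2,…,11}`, the
class `2, 3, 5, 7, 11 ∈ S ∌ 13`).  Honest framing: theorems about the tree's `weilSemilocalThreshold S`; nothing here bears
on RH.  No data is trusted: eight kernel facts (`decide +kernel`, seconds each) of the PIECEWISE certificate `certEleven130`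
(`WeilNegCertP`, `SemilocalNegCertPieces.lean`; window `2b = 2.6`).

Instance data: `S = {2,3,5,7,11}`, window `N = 15` (`b < (log 16)/2 = 2 log 2`), atoms = the `S`-smooth prime powers
`≤ 15`: `2, 3, 4, 5, 7, 8, 9, 11` (`atomsEleven`; enclosures `SemilocalLogAtoms.lean`, incl. `log 7`, `log 11` to 11 decimals;
`15 = 3·5` is not a prime power — `not_isPrimePow_of_two_primes_dvd`, since `decide` cannot see through `Nat.minFac` at odd
composites).  Witness (lineage B of the A4 table, bottom vector of the odd Legendre section `d = 9` at `b = 13/10`, rounded;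
certified independently by `witness_exact.py`): `Re Q_S(G)/‖G‖² = −2.0183…·10⁻³` ⇒ **`weilSemilocalThreshold {2,3,5,7,11} ≤ 13/10`**
(kernel margin `2.015·10⁻³`; bulk `(0, 2.6]` in six pieces, majorant `archMajorCL 10 3 5 u₀`).  Locality (`N = 15`):
**`a*(S) = a*({2,…,11}) ∈ [0.8046, 1.3]` for every finite `S` with `2, 3, 5, 7, 11 ∈ S`, `13 ∉ S`** (DATA, one engine
certified: `a* ≤ 1.28295`).  Folklore throughout.
-/

set_option autoImplicit false
set_option linter.dupNamespace false  -- the mandated namespace repeats `RiemannHypothesis`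

noncomputable section

open Complex Filter Set MeasureTheory Topology
open scoped Real

namespace Summit.RiemannHypothesis.RiemannHypothesis.Theorems.SemilocalPolyWitness

open MeasureTheory Set Finset Real
open Literature.NumberTheory.LFunctions
open Summit.RiemannHypothesis.RiemannHypothesis.Theorems.MotivicDoor
open Summit.RiemannHypothesis.RiemannHypothesis.Theorems.MotivicDoor.SemilocalThreshold
open Summit.RiemannHypothesis.RiemannHypothesis.Theorems.MotivicDoor.SemilocalMarkov
open LQ


/-- A number divisible by two distinct primes is not a prime power. -/
theorem not_isPrimePow_of_two_primes_dvd {n p q : ℕ} (hp : p.Prime) (hq : q.Prime) (hpq : p ≠ q) (hpn : p ∣ n)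
    (hqn : q ∣ n) : ¬ IsPrimePow n := by
  rintro ⟨r, k, hr, hk, rfl⟩
  have hr' : r.Prime := Nat.prime_iff.2 hr
  have e1 := (Nat.prime_dvd_prime_iff_eq hp hr').1 (hp.dvd_of_dvd_pow hpn)
  have e2 := (Nat.prime_dvd_prime_iff_eq hq hr').1 (hq.dvd_of_dvd_pow hqn)
  exact hpq (e1.trans e2.symm)

/-! ### The atom table of the `{2, 3, 5, 7, 11}`-form on windows `b < (log 16)/2` (`N = 15`) -/

/-- The atoms of the `{2, 3, 5, 7, 11}`-form below `(log 16)/2`: `2, 3, 4, 5, 7, 8, 9, 11`. -/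
def atomsEleven : List (ℕ × AtomQ) := [atomTwo, atomThree, atomFour, atomFive, atomSeven, atomEight, atomNine, atomEleven]

/-- A rational lower bound of `log 16`. -/
def logSuccLoEleven : ℚ := 4 * logTwoLo20

/-- **The atom table encloses `({2, 3, 5, 7, 11}, 15)`.** -/
theorem atomsEnclose_Eleven : AtomsEnclose {2, 3, 5, 7, 11} 15 atomsEleven logSuccLoEleven where
  nodup := by decide
  lt_succ := by decide
  cover := by
    intro n hn hnot
    simp only [atomsEleven, atomTwo, atomThree, atomFour, atomFive, atomSeven, atomEight, atomNine, atomEleven, List.map_cons, List.map_nil, List.mem_cons,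
      List.not_mem_nil, or_false, not_or] at hnot
    have hn' : n < 16 := Finset.mem_range.1 hn
    interval_cases n
    · exact weilSemilocalCoeff_of_not_isPrimePow _ (by decide)
    · exact weilSemilocalCoeff_of_not_isPrimePow _ (by decide)
    · simp at hnot
    · simp at hnot
    · simp at hnot
    · simp at hnot
    · exact weilSemilocalCoeff_of_not_isPrimePow _ (by decide)
    · simp at hnot
    · simp at hnot
    · simp at hnot
    · exact weilSemilocalCoeff_of_not_isPrimePow _ (by decide)
    · simp at hnot
    · exact weilSemilocalCoeff_of_not_isPrimePow _ (by decide)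
    · exact weilSemilocalCoeff_prime_of_not_mem (by norm_num) (by decide)
    · exact weilSemilocalCoeff_of_not_isPrimePow _ (by decide)
    · exact weilSemilocalCoeff_of_not_isPrimePow _ (not_isPrimePow_of_two_primes_dvd Nat.prime_three (by norm_num : Nat.Prime 5) (by norm_num) (by norm_num) (by norm_num))
  encl := by
    intro na hna
    simp only [atomsEleven, List.mem_cons, List.not_mem_nil, or_false] at hna
    rcases hna with rfl | rfl | rfl | rfl | rfl | rfl | rfl | rfl
    · exact atomTwo_encl (by decide)
    · exact atomThree_encl (by decide)
    · exact atomFour_encl (by decide)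
    · exact atomFive_encl (by decide)
    · exact atomSeven_encl (by decide)
    · exact atomEight_encl (by decide)
    · exact atomNine_encl (by decide)
    · exact atomEleven_encl (by decide)
  logSucc := by
    have h2 := logTwoLo20_le
    have h16 : Real.log (((15 : ℕ) : ℝ) + 1) = 4 * Real.log 2 := by
      rw [show ((15 : ℕ) : ℝ) + 1 = 2 ^ 4 by norm_num, Real.log_pow]; push_cast; ring
    rw [h16, logSuccLoEleven]; push_cast; linarith

/-! ### The certificates -/

/-- The degree-9 witness at `b = 13 / 10` (bottom vector of the odd Legendre section d = 9, rounded to 8 digits; lineage-B certified margin Re Q_S/‖G‖² = −2.0183·10⁻³), in powers of `x`. -/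
def pEleven130 : List ℚ :=
  [0, 5740961185 / 32, 0, -6932873180625 / 4394, 0, 1226054488246875 / 371293, 0, -11244582628125000 / 4826809, 0, 433598346328125000 / 815730721]

/-- The piecewise certificate at `b = 13 / 10`: orders `(nA, mA, KA, Kt, nt, ne) = (10, 3, 5, 10, 40, 16)`, cuts `[1, 3 / 2, 19 / 10, 11 / 5, 5 / 2, 13 / 5]`,
claimed piece bounds and atom bound (exact rational values rounded up to integers). -/
def certEleven130 : WeilNegCertP :=
  ⟨pEleven130, 13 / 10, 10, 3, 5, 10, 40, 16, atomsEleven, logSuccLoEleven,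
   [1, 3 / 2, 19 / 10, 11 / 5, 5 / 2, 13 / 5],
   [21396722564411769, 5841541093950477, 2801105052525607, 2632099590794341, 2184311423649548, 528702045902839], 86169189193319090⟩

set_option maxHeartbeats 0 in
/-- kernel fact: side conditions and the final inequality of `certEleven130`. -/
theorem check_Eleven130_main : certEleven130.checkMain c0SharpQ = true := by
  decide +kernel

set_option maxHeartbeats 0 in
/-- kernel fact: the atom side of `certEleven130`. -/
theorem check_Eleven130_atoms : certEleven130.checkAtoms = true := by
  decide +kernel

set_option maxHeartbeats 0 in
/-- kernel fact: piece `0` of `certEleven130`. -/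
theorem check_Eleven130_piece0 : certEleven130.checkPiece 0 = true := by
  decide +kernel

set_option maxHeartbeats 0 in
/-- kernel fact: piece `1` of `certEleven130`. -/
theorem check_Eleven130_piece1 : certEleven130.checkPiece 1 = true := by
  decide +kernel

set_option maxHeartbeats 0 in
/-- kernel fact: piece `2` of `certEleven130`. -/
theorem check_Eleven130_piece2 : certEleven130.checkPiece 2 = true := by
  decide +kernel

set_option maxHeartbeats 0 in
/-- kernel fact: piece `3` of `certEleven130`. -/
theorem check_Eleven130_piece3 : certEleven130.checkPiece 3 = true := by
  decide +kernel

set_option maxHeartbeats 0 in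
/-- kernel fact: piece `4` of `certEleven130`. -/
theorem check_Eleven130_piece4 : certEleven130.checkPiece 4 = true := by
  decide +kernel

set_option maxHeartbeats 0 in
/-- kernel fact: piece `5` of `certEleven130`. -/
theorem check_Eleven130_piece5 : certEleven130.checkPiece 5 = true := by
  decide +kernel

/-- all pieces of `certEleven130` check. -/
theorem check_Eleven130_pieces : ∀ i, i < certEleven130.cuts.length → certEleven130.checkPiece i = true := by
  intro i hi
  have hi' : i < 6 := hi
  interval_cases i
  · exact check_Eleven130_piece0
  · exact check_Eleven130_piece1
  · exact check_Eleven130_piece2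
  · exact check_Eleven130_piece3
  · exact check_Eleven130_piece4
  · exact check_Eleven130_piece5

/-! ### The theorems -/

/-- **`a*({2,3,5,7,11}) ≤ 13/10`.** -/
theorem weilSemilocalThreshold_uptoEleven_le_130 :
    weilSemilocalThreshold {2, 3, 5, 7, 11} ≤ ((13 / 10 : ℚ) : ℝ) :=
  weilSemilocalThreshold_le_of_checkP_sharp certEleven130 atomsEnclose_Eleven
    check_Eleven130_main check_Eleven130_atoms check_Eleven130_pieces

/-- Failure form: `{∞,2,…,11}`-positivity fails on every cone `C(B)`, `B > 13/10`. -/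
theorem not_weilSemilocalPositivityOn_uptoEleven_of_gt {B : ℝ} (hB : (13 / 10 : ℝ) < B) :
    ¬ WeilSemilocalPositivityOn {2, 3, 5, 7, 11} B := by
  rw [not_weilSemilocalPositivityOn_iff_weilSemilocalThreshold_lt]
  have h := weilSemilocalThreshold_uptoEleven_le_130
  push_cast at h
  linarith

/-- `a*({2,…,11}) < (log 16)/2`: below the window where the prime power `16` would enter. -/
theorem weilSemilocalThreshold_uptoEleven_lt_log_sixteen_half :
    weilSemilocalThreshold {2, 3, 5, 7, 11} < Real.log 16 / 2 := by
  have h := weilSemilocalThreshold_uptoEleven_le_130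
  have h2 := Real.log_two_gt_d9
  have h16 : Real.log 16 = 4 * Real.log 2 := by
    rw [show (16 : ℝ) = 2 ^ 4 by norm_num, Real.log_pow]; push_cast; ring
  push_cast at h
  rw [h16]
  linarith

/-- **The class `2, 3, 5, 7, 11 ∈ S ∌ 13`**: `a*(S) = a*({2,…,11})` (locality at `N = 15`). -/
theorem weilSemilocalThreshold_eq_uptoEleven {S : Finset ℕ} (h2 : 2 ∈ S) (h3 : 3 ∈ S) (h5 : 5 ∈ S) (h7 : 7 ∈ S)
    (h11 : 11 ∈ S) (h13 : 13 ∉ S) : weilSemilocalThreshold S = weilSemilocalThreshold {2, 3, 5, 7, 11} := by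
  refine weilSemilocalThreshold_congr (S := {2, 3, 5, 7, 11}) (S' := S) (N := 15) ?_ ?_
  · intro n hn hpp
    interval_cases n
    · exact absurd hpp (by decide)
    · exact absurd hpp (by decide)
    · rw [Nat.prime_two.primeFactors]; simp [h2]
    · rw [Nat.prime_three.primeFactors]; simp [h3]
    · rw [show (4 : ℕ) = 2 ^ 2 by norm_num, Nat.primeFactors_prime_pow two_ne_zero Nat.prime_two]; simp [h2]
    · rw [(by norm_num : Nat.Prime 5).primeFactors]; simp [h5]
    · exact absurd hpp (by decide)
    · rw [(by norm_num : Nat.Prime 7).primeFactors]; simp [h7]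
    · rw [show (8 : ℕ) = 2 ^ 3 by norm_num, Nat.primeFactors_prime_pow (by norm_num) Nat.prime_two]; simp [h2]
    · rw [show (9 : ℕ) = 3 ^ 2 by norm_num, Nat.primeFactors_prime_pow two_ne_zero Nat.prime_three]; simp [h3]
    · exact absurd hpp (by decide)
    · rw [(by norm_num : Nat.Prime 11).primeFactors]; simp [h11]
    · exact absurd hpp (by decide)
    · rw [(by norm_num : Nat.Prime 13).primeFactors]; simp [h13]
    · exact absurd hpp (by decide)
    · exact absurd hpp (not_isPrimePow_of_two_primes_dvd Nat.prime_three (by norm_num : Nat.Prime 5) (by norm_num)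
        (by norm_num) (by norm_num))
  · have h := weilSemilocalThreshold_uptoEleven_lt_log_sixteen_half
    norm_num
    exact h

/-- **`a*(S) ≤ 13/10` for every finite set of primes `S` with `2, 3, 5, 7, 11 ∈ S`, `13 ∉ S`.** -/
theorem weilSemilocalThreshold_le_130_of_mem {S : Finset ℕ} (h2 : 2 ∈ S) (h3 : 3 ∈ S) (h5 : 5 ∈ S) (h7 : 7 ∈ S)
    (h11 : 11 ∈ S) (h13 : 13 ∉ S) : weilSemilocalThreshold S ≤ ((13 / 10 : ℚ) : ℝ) := by
  rw [weilSemilocalThreshold_eq_uptoEleven h2 h3 h5 h7 h11 h13]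
  exact weilSemilocalThreshold_uptoEleven_le_130

/-- **The bracket of the class `2, …, 11 ∈ S ∌ 13`**: `4023/5000 ≤ a*(S) ≤ 13/10` (DATA `≈ 1.283`). -/
theorem weilSemilocalThreshold_mem_Icc_of_mem_eleven {S : Finset ℕ} (h2 : 2 ∈ S) (h3 : 3 ∈ S) (h5 : 5 ∈ S)
    (h7 : 7 ∈ S) (h11 : 11 ∈ S) (h13 : 13 ∉ S) :
    weilSemilocalThreshold S ∈ Set.Icc (4023 / 5000 : ℝ) ((13 / 10 : ℚ) : ℝ) :=
  ⟨SemilocalTwoThree.le_weilSemilocalThreshold_of_two_three_8046 h2 h3,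
    weilSemilocalThreshold_le_130_of_mem h2 h3 h5 h7 h11 h13⟩

end Summit.RiemannHypothesis.RiemannHypothesis.Theorems.SemilocalPolyWitness

end

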